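import Literature.Analysis.FluidPDE.FluidComputer.ThresholdLevelTableA3
import HarnessLib

/-!
# Kernel run of the A = 3 level-table checker, chunks 16 … 19 (steps 400 … 499) (bp3 gen 13, layer 4)

HONEST FRAMING: low prior, high value-of-information experiment on Tao's machine paradigm; NOT a
claim that NS blows up.

Four kernel evaluations (`decide +kernel`; no `native_decide`, no extra axioms) of the checker
`runSteps` (`ThresholdLevelCheck.lean`) on 25 steps of `ThresholdLevelTableA3.stepsT` at a time, from
the entry box `Bc i` towards the next chunk's first level, returning the entry box `Bc (i+1)`
(≈ 30 s of kernel time per chunk; same scheme as `ThresholdLevelTableRun0 … 7` for A = 2).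
-/

namespace Literature.Analysis.FluidPDE.FluidComputer

namespace ThresholdLevelTableA3

set_option maxHeartbeats 10000000 in
set_option maxRecDepth 200000 in
/-- Chunk 16 of the A = 3 table run (steps 400 … 424). [folklore] -/
theorem run16 : runSteps 60 12 3 GIt RbIt Bc16 chunk16 6242277276938228 = some Bc17 := by
  decide +kernel

set_option maxHeartbeats 10000000 in
set_option maxRecDepth 200000 in
/-- Chunk 17 of the A = 3 table run (steps 425 … 449). [folklore] -/
theorem run17 : runSteps 60 12 3 GIt RbIt Bc17 chunk17 7442803679809304 = some Bc18 := by
  decide +kernel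

set_option maxHeartbeats 10000000 in
set_option maxRecDepth 200000 in
/-- Chunk 18 of the A = 3 table run (steps 450 … 474). [folklore] -/
theorem run18 : runSteps 60 12 3 GIt RbIt Bc18 chunk18 8874217558524365 = some Bc19 := by
  decide +kernel

set_option maxHeartbeats 10000000 in
set_option maxRecDepth 200000 in
/-- Chunk 19 of the A = 3 table run (steps 475 … 499). [folklore] -/
theorem run19 : runSteps 60 12 3 GIt RbIt Bc19 chunk19 10580923622862496 = some Bc20 := by
  decide +kernel

end ThresholdLevelTableA3

end Literature.Analysis.FluidPDE.FluidComputer
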